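import Literature.Probability.RandomPlanarGeometry.HexSAWRotSurfaceYcLimitAllY
import Literature.Probability.RandomPlanarGeometry.HexSAWArmchairWallRateSqrtMonotone
import Literature.Probability.RandomPlanarGeometry.HexSAWRotSurfaceDensityLimit
import Mathlib.Analysis.Convex.Deriv
import HarnessLib

/-!
# Beaton's rotated honeycomb surface — the ORDER PARAMETER: the one-sided densities `ρ⁻_μ(t) ≤ ρ⁺_μ(t)` of the surface free
# energy `F(t) = log μ(eᵗ)`; `ρ⁻_μ(t) = 0 ↔ eᵗ ≤ y_c`, `ρ⁻_μ(t) > 0` for `eᵗ > y_c`; and the mean density of surface vertices of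
# `n`-step walks is squeezed between them for EVERY fugacity: `ρ⁻_μ(t) − ε ≤ density_n(eᵗ) ≤ ρ⁺_μ(t) + ε` eventually

Topic `Literature/Probability/RandomPlanarGeometry` (lane «pcv-sawmu», rotated-door lineage; assembles three tree files:
`HexSAWRotSurfaceYcLimitAllY.lean` — `μ(y) := rotSurfaceMu y = lim C⁺_n(y)^{1/n}` for every `y > 0`, `rotSurfaceMu_eq_iff : μ(y) = μ ↔
y ≤ y†`, `rotSurfaceMu_eq_armRate (y† < y)`;  `HexSAWArmchairWallRateSqrtMonotone.lean` — `HV.convexOn_log_rotSurfaceMu_exp`,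
`HV.log_rotSurfaceMu_sub_mem_Icc` and (EDITION 7) the armchair densities `Arm.armFreeEnergy`, `Arm.armRightDensity = ρ⁺`,
`Arm.armLeftDensity = ρ⁻`, `ρ± → ½`, `ρ⁺ < ½`;  `HexSAWRotSurfaceDensityLimit.lean` — the secant lemmas `eventually_rotSurfDensity_lt` /
`eventually_lt_rotSurfDensity` for the finite-`n` density `rotSurfDensity n y` of `HexSAWRotSurfaceDensity.lean`).

Source.  N. R. Beaton, *The critical surface fugacity of self-avoiding walks on a rotated honeycomb lattice*, J. Phys. A 47 (2014)
075003 = arXiv:1210.0274v3, §3.1: Proposition 7 (p. 11: "`μ(y)` … is a log-convex, non-decreasing function of `log y`, and therefore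
continuous and almost everywhere differentiable … `μ(y) = μ` if `y ≤ y_c`, `> μ` if `y > y_c`") and the last paragraph of §3.1
(p. 14: "In the limit of infinitely long walks, this density tends to `y ∂ log μ(y)/∂y`. From the behaviour of `μ(y)` given in
Proposition 7, it can be seen that the density of vertices in the surface is `0` for `y < y_c` and is positive for `y > y_c`.");
Theorem 1 (p. 2: `y_c = y† = rotYdagger`).  E. J. Janse van Rensburg, S. G. Whittington, J. Phys. A 46 (2013) 435003, §3.1 eq. (3.4)
(arXiv v4 p. 6: the left/right densities `𝓔_±` of the hypercubic model, "exist for every finite a > 0 since κ(a) is a convex function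
of log a … `𝓔_-(a) ≤ 𝓔_+(a)` … monotone … Clearly `𝓔(a) = 0` if `a < a_c` and `𝓔(a) > 0` for almost all `a > a_c`").

## What is proved (namespace `Literature.Probability.RandomPlanarGeometry.SAW.HV`; no hypotheses beyond `0 < y`)

* vocabulary: `rotFreeEnergy t = F(t) := log μ(eᵗ)`, `rotRightDensity t = ρ⁺_μ(t) := d⁺F/dt`, `rotLeftDensity t = ρ⁻_μ(t) := d⁻F/dt`
  (Mathlib one-sided `derivWithin`); `convexOn_rotFreeEnergy`, `hasDerivWithinAt_rotRightDensity` / `…Left…` (they ARE the one-sided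
  derivatives, at every `t`), `rotDensities_mem_Icc` (`0 ≤ ρ⁻_μ ≤ ρ⁺_μ ≤ ½`), `monotone_rotRightDensity` / `monotone_rotLeftDensity`,
  the interlacing `rotRightDensity_le_rotLeftDensity_of_lt`, chord sandwich;
* THE ORDER PARAMETER: `rotFreeEnergy_eq_of_le` (`F = log μ` on `eᵗ ≤ y†`), `rotRightDensity_eq_zero_of_lt` (`eᵗ < y†`),
  **`rotLeftDensity_eq_zero_iff : ρ⁻_μ(t) = 0 ↔ eᵗ ≤ y†`**, **`rotLeftDensity_pos_iff : 0 < ρ⁻_μ(t) ↔ y† < eᵗ`** with the explicit chord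
  bound `div_le_rotLeftDensity : (F(t) − log μ)/(t − log y†) ≤ ρ⁻_μ(t)` (`y† < eᵗ`) — «`0` for `y < y_c` and positive for `y > y_c`»
  for the LEFT density at EVERY `y` (print: "for almost all");
  `deriv_rotSurfaceMu_pos` (`μ′(y) > 0` at every `y > y†` where `μ` is differentiable) and `rotSurfaceDensity_dichotomy`;
* identification with the armchair densities in the adsorbed phase: `rotFreeEnergy_eventuallyEq_armFreeEnergy (y† < eᵗ)`,
  `rotRightDensity_eq_armRightDensity` / `rotLeftDensity_eq_armLeftDensity` (`y† < eᵗ`); hence `tendsto_rotRightDensity_atTop` /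
  `tendsto_rotLeftDensity_atTop` (`→ ½`) and **`rotRightDensity_lt_half : ρ⁺_μ(t) < ½` at EVERY `t`**;
* the set of fugacities where `ρ⁻_μ ≠ ρ⁺_μ` is countable: **`countable_setOf_rotLeftDensity_lt_rotRightDensity`** (the open intervals
  `(ρ⁻_μ(t), ρ⁺_μ(t))` are pairwise disjoint by the interlacing);
* THE FINITE-`n` DENSITY IS SQUEEZED BY THE ONE-SIDED DENSITIES AT EVERY FUGACITY: `eventually_rotSurfDensity_lt_of_lt` (`ρ⁺_μ(t) < b ⇒
  density_n(eᵗ) < b` eventually), `eventually_lt_rotSurfDensity_of_lt` (`a < ρ⁻_μ(t) ⇒ a < density_n(eᵗ)` eventually),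
  **`tendsto_rotSurfDensity_exp_of_eq : ρ⁻_μ(t) = ρ⁺_μ(t) → density_n(eᵗ) → ρ⁺_μ(t)`** — so the printed «this density tends to
  `y ∂ log μ(y)/∂y`» holds at every `y > 0` outside a countable set (`tendsto_rotSurfDensity_exp_of_not_mem`), and at EVERY `y > y_c`
  the densities are eventually `≥ ρ⁻_μ − ε > 0`.

* (EDITION 3, appended) the exceptional set IN THE FUGACITY: `Arm.countable_setOf_armLeftDensity_lt_armRightDensity`,
  `Arm.hasDerivAt_armFreeEnergy_of_eq` / `armLeftDensity_eq_armRightDensity_of_differentiableAt`, `Arm.differentiableAt_armRate_exp_iff`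
  (`β_rot` differentiable at `eᵗ` ↔ `κ_rot` differentiable at `t`), **`Arm.countable_setOf_not_differentiableAt_armRate`** and
  **`HV.countable_setOf_not_differentiableAt_rotSurfaceMu`** — `β_rot` and Beaton's `μ(·)` are differentiable at every `y > 0` outside a
  COUNTABLE set (print: "almost everywhere differentiable", i.e. off a Lebesgue-null set) —, `HV.differentiableAt_rotSurfaceMu_exp_iff`,
  `rotLeftDensity_eq_rotRightDensity_of_differentiableAt`, and `HV.tendsto_rotSurfDensity_of_not_mem` (the printed density limit
  `density_n(y) → y μ′(y)/μ(y)` at every `y > 0` off that countable set).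

LABEL (author's proposal): CONSOLIDATION AS PRINTED of Beaton §3.1 (Prop. 7's convexity clauses + the density paragraph) in the
Janse van Rensburg–Whittington left/right-density vocabulary, for the rotated frame; lane corollaries XS: the `iff`s for the left density
at every `y`, the countable exceptional set (in `t` and, edition 3, in `y`, for `β_rot` and `μ`), `ρ⁺_μ < ½`.  Not claimed: the value of
`ρ⁺_μ` AT `y_c` (the order of the transition), differentiability of `μ(·)` at any SPECIFIC `y > y_c`.
EDITIONS: ed.1 3d88ead077009f96; ed.2 a73895bd7c69e4df = ed.1 ⊕ `deriv_rotSurfaceMu_pos`, `rotSurfaceDensity_dichotomy` (re-homed from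
`HexSAWRotSurfaceYcProp7Riders` ed.2) — the landed edition (p378589); ed.3 (this) = ed.2 with every declaration byte-identical ⊕ the
appended section «EDITION 3» (9 theorems) and this header's edition-3 bullet / label clause.
-/

noncomputable section

open Finset Filter Function
open _root_.Topology

namespace Literature.Probability.RandomPlanarGeometry.SAW.HV

open HexBW HexBW.Arm

variable {y : ℝ}

/-! ### Vocabulary: the free energy of Beaton's `μ(y)` and its one-sided densities -/

/-- **`F(t) := log μ(eᵗ)`**, the surface free energy of Beaton's rotated model as a function of `t = log y` (convex:
`convexOn_log_rotSurfaceMu_exp`). [cite: Beaton2014RotatedHoneycomb, §3.1, Proposition 7 (arXiv v3 p. 11: "log-convex, non-decreasing function of log y")] -/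
def rotFreeEnergy (t : ℝ) : ℝ := Real.log (rotSurfaceMu (Real.exp t))

/-- **`ρ⁺_μ(t) := d⁺F/dt`**, the RIGHT density of surface vertices at fugacity `y = eᵗ`.
[cite: Beaton2014RotatedHoneycomb, §3.1, last paragraph (arXiv v3 p. 14: "this density tends to y ∂ log μ(y)/∂y"); JansevanRensburgWhittington2013, §3.1 eq. (3.4) (arXiv v4 p. 6: hypercubic 𝓔_+)] -/
def rotRightDensity (t : ℝ) : ℝ := derivWithin rotFreeEnergy (Set.Ioi t) t

/-- **`ρ⁻_μ(t) := d⁻F/dt`**, the LEFT density of surface vertices at fugacity `y = eᵗ` — the order parameter.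
[cite: Beaton2014RotatedHoneycomb, §3.1, last paragraph (arXiv v3 p. 14); JansevanRensburgWhittington2013, §3.1 eq. (3.4) (arXiv v4 p. 6: hypercubic 𝓔_-)] -/
def rotLeftDensity (t : ℝ) : ℝ := derivWithin rotFreeEnergy (Set.Iio t) t

/-- `F(t) = log μ(eᵗ)` (unfolding). [cite: Beaton2014RotatedHoneycomb, §3.1, Proposition 7 (arXiv v3 p. 11)] -/
theorem rotFreeEnergy_apply (t : ℝ) : rotFreeEnergy t = Real.log (rotSurfaceMu (Real.exp t)) := rfl

/-- **`F` is convex on `ℝ`** (= `convexOn_log_rotSurfaceMu_exp`). [cite: Beaton2014RotatedHoneycomb, §3.1, Proposition 7 (arXiv v3 p. 11: "log-convex … function of log y")] -/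
theorem convexOn_rotFreeEnergy : ConvexOn ℝ Set.univ rotFreeEnergy := convexOn_log_rotSurfaceMu_exp

/-- `0 ≤ F(t') − F(t) ≤ (t' − t)/2` for `t ≤ t'` (= `log_rotSurfaceMu_sub_mem_Icc` in the variable `t = log y`).
[cite: Beaton2014RotatedHoneycomb, §3.1, Proposition 7 (arXiv v3 p. 11: "non-decreasing")] -/
theorem rotFreeEnergy_sub_mem_Icc {t t' : ℝ} (htt' : t ≤ t') :
    rotFreeEnergy t' - rotFreeEnergy t ∈ Set.Icc (0 : ℝ) ((t' - t) / 2) := by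
  have h := log_rotSurfaceMu_sub_mem_Icc (Real.exp_pos t) (Real.exp_le_exp.2 htt')
  rwa [Real.log_exp, Real.log_exp] at h

/-- Every chord of `F` has slope in `[0, ½]`. [cite: Beaton2014RotatedHoneycomb, §3.1, Proposition 7 (arXiv v3 p. 11)] -/
theorem slope_rotFreeEnergy_mem_Icc {t t' : ℝ} (h : t < t') : slope rotFreeEnergy t t' ∈ Set.Icc (0 : ℝ) (1 / 2) := by
  obtain ⟨h0, h1⟩ := rotFreeEnergy_sub_mem_Icc h.le
  have hpos : 0 < t' - t := sub_pos.2 h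
  rw [slope_def_field]
  exact ⟨div_nonneg h0 hpos.le, (div_le_iff₀ hpos).2 (by linarith)⟩

/-- `ρ⁺_μ(t)` IS the right derivative of `F` at `t`. [cite: Beaton2014RotatedHoneycomb, §3.1, Proposition 7 (arXiv v3 p. 11: "almost everywhere differentiable"); JansevanRensburgWhittington2013, §3.1 eq. (3.4) (arXiv v4 p. 6: «These exist for every finite a > 0 since κ(a) is a convex function of log a»)] -/
theorem hasDerivWithinAt_rotRightDensity (t : ℝ) : HasDerivWithinAt rotFreeEnergy (rotRightDensity t) (Set.Ioi t) t :=
  convexOn_rotFreeEnergy.hasDerivWithinAt_rightDeriv_of_mem_interior (by simp)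

/-- `ρ⁻_μ(t)` IS the left derivative of `F` at `t`. [cite: Beaton2014RotatedHoneycomb, §3.1, Proposition 7 (arXiv v3 p. 11); JansevanRensburgWhittington2013, §3.1 eq. (3.4) (arXiv v4 p. 6)] -/
theorem hasDerivWithinAt_rotLeftDensity (t : ℝ) : HasDerivWithinAt rotFreeEnergy (rotLeftDensity t) (Set.Iio t) t :=
  convexOn_rotFreeEnergy.hasDerivWithinAt_leftDeriv_of_mem_interior (by simp)

/-- `ρ⁻_μ(t) ≤ ρ⁺_μ(t)`. [cite: Beaton2014RotatedHoneycomb, §3.1, Proposition 7 (arXiv v3 p. 11); JansevanRensburgWhittington2013, §3.1 eq. (3.4) (arXiv v4 p. 6: «𝓔_-(a) ≤ 𝓔_+(a)»)] -/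
theorem rotLeftDensity_le_rotRightDensity (t : ℝ) : rotLeftDensity t ≤ rotRightDensity t :=
  convexOn_rotFreeEnergy.leftDeriv_le_rightDeriv_of_mem_interior (by simp)

/-- `ρ⁺_μ` is non-decreasing. [cite: Beaton2014RotatedHoneycomb, §3.1, Proposition 7 (arXiv v3 p. 11: "log-convex"); JansevanRensburgWhittington2013, §3.1 (arXiv v4 p. 6: «monotone functions»)] -/
theorem monotone_rotRightDensity : Monotone rotRightDensity := by
  intro t t' h
  have := convexOn_rotFreeEnergy.monotoneOn_rightDeriv (by simp : t ∈ interior (Set.univ : Set ℝ)) (by simp) h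
  simpa [rotRightDensity] using this

/-- `ρ⁻_μ` is non-decreasing. [cite: Beaton2014RotatedHoneycomb, §3.1, Proposition 7 (arXiv v3 p. 11: "log-convex"); JansevanRensburgWhittington2013, §3.1 (arXiv v4 p. 6)] -/
theorem monotone_rotLeftDensity : Monotone rotLeftDensity := by
  intro t t' h
  have := convexOn_rotFreeEnergy.monotoneOn_leftDeriv (by simp : t ∈ interior (Set.univ : Set ℝ)) (by simp) h
  simpa [rotLeftDensity] using this

/-- `ρ⁺_μ(t) ≤ slope F t t'` for `t < t'`. [cite: Beaton2014RotatedHoneycomb, §3.1, Proposition 7 (arXiv v3 p. 11: "log-convex")] -/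
theorem rotRightDensity_le_slope {t t' : ℝ} (h : t < t') : rotRightDensity t ≤ slope rotFreeEnergy t t' :=
  convexOn_rotFreeEnergy.rightDeriv_le_slope_of_mem_interior (by simp) (Set.mem_univ t') h

/-- `slope F t t' ≤ ρ⁻_μ(t')` for `t < t'`. [cite: Beaton2014RotatedHoneycomb, §3.1, Proposition 7 (arXiv v3 p. 11: "log-convex")] -/
theorem slope_le_rotLeftDensity {t t' : ℝ} (h : t < t') : slope rotFreeEnergy t t' ≤ rotLeftDensity t' :=
  convexOn_rotFreeEnergy.slope_le_leftDeriv_of_mem_interior (Set.mem_univ t) (by simp) h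

/-- The one-sided densities interlace: `ρ⁺_μ(t) ≤ ρ⁻_μ(t')` for `t < t'`. [cite: Beaton2014RotatedHoneycomb, §3.1, Proposition 7 (arXiv v3 p. 11: "log-convex")] -/
theorem rotRightDensity_le_rotLeftDensity_of_lt {t t' : ℝ} (h : t < t') : rotRightDensity t ≤ rotLeftDensity t' :=
  (rotRightDensity_le_slope h).trans (slope_le_rotLeftDensity h)

/-- **`0 ≤ ρ⁻_μ(t) ≤ ρ⁺_μ(t) ≤ ½` at every `t`.** [cite: Beaton2014RotatedHoneycomb, §3.1, Proposition 7 (arXiv v3 p. 11: "non-decreasing … μ(y) ≥ max{μ, √y}")] -/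
theorem rotDensities_mem_Icc (t : ℝ) :
    0 ≤ rotLeftDensity t ∧ rotLeftDensity t ≤ rotRightDensity t ∧ rotRightDensity t ≤ 1 / 2 :=
  ⟨(slope_rotFreeEnergy_mem_Icc (sub_one_lt t)).1.trans (slope_le_rotLeftDensity (sub_one_lt t)),
    rotLeftDensity_le_rotRightDensity t,
    (rotRightDensity_le_slope (lt_add_one t)).trans (slope_rotFreeEnergy_mem_Icc (lt_add_one t)).2⟩

/-! ### The order parameter: zero exactly up to `y_c`, positive beyond -/

/-- **Desorbed phase: `F(t) = log μ` whenever `eᵗ ≤ y†`.** [cite: Beaton2014RotatedHoneycomb, §3.1, Proposition 7 (arXiv v3 p. 11: "μ(y) = μ if y ≤ y_c") and Theorem 1 (p. 2: y_c = y†)] -/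
theorem rotFreeEnergy_eq_of_le {t : ℝ} (ht : Real.exp t ≤ rotYdagger) : rotFreeEnergy t = Real.log hexConnectiveConstant := by
  rw [rotFreeEnergy_apply, (rotSurfaceMu_eq_iff (Real.exp_pos t)).2 ht]

/-- `log μ ≤ F(t)` at every `t`. [cite: Beaton2014RotatedHoneycomb, §3.1, Proposition 7 (arXiv v3 p. 11: "μ(y) ≥ max{μ, √y}")] -/
theorem log_hexConnectiveConstant_le_rotFreeEnergy (t : ℝ) : Real.log hexConnectiveConstant ≤ rotFreeEnergy t :=
  Real.log_le_log (by rw [hexConnectiveConstant_eq_inv]; exact inv_pos.2 hexCriticalFugacity_pos_lt_one.1)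
    (hexConnectiveConstant_le_rotSurfaceMu _)

/-- **Adsorbed phase: `log μ < F(t)` whenever `y† < eᵗ`.** [cite: Beaton2014RotatedHoneycomb, §3.1, Proposition 7 (arXiv v3 p. 11: "> μ if y > y_c")] -/
theorem log_hexConnectiveConstant_lt_rotFreeEnergy {t : ℝ} (ht : rotYdagger < Real.exp t) :
    Real.log hexConnectiveConstant < rotFreeEnergy t :=
  Real.log_lt_log (by rw [hexConnectiveConstant_eq_inv]; exact inv_pos.2 hexCriticalFugacity_pos_lt_one.1)
    ((hexConnectiveConstant_lt_rotSurfaceMu_iff (Real.exp_pos t)).2 ht)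

/-- **`ρ⁺_μ(t) = 0` for `eᵗ < y†`** (zero density strictly below the transition: `F` is constant on a neighbourhood).
[cite: Beaton2014RotatedHoneycomb, §3.1, last paragraph (arXiv v3 p. 14: "the density of vertices in the surface is 0 for y < y_c")] -/
theorem rotRightDensity_eq_zero_of_lt {t : ℝ} (ht : Real.exp t < rotYdagger) : rotRightDensity t = 0 := by
  refine le_antisymm ?_ ((rotDensities_mem_Icc t).1.trans (rotLeftDensity_le_rotRightDensity t))
  -- a right chord inside the constant region has slope 0
  have hlt : t < Real.log rotYdagger := (Real.lt_log_iff_exp_lt rotYdagger_pos).2 ht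
  set t' : ℝ := (t + Real.log rotYdagger) / 2 with ht'
  have htt' : t < t' := by rw [ht']; linarith
  have ht'c : Real.exp t' ≤ rotYdagger := by
    have : t' < Real.log rotYdagger := by rw [ht']; linarith
    exact ((Real.lt_log_iff_exp_lt rotYdagger_pos).1 this).le
  have hs : slope rotFreeEnergy t t' = 0 := by
    rw [slope_def_field, rotFreeEnergy_eq_of_le ht'c, rotFreeEnergy_eq_of_le ht.le, sub_self, zero_div]
  exact (rotRightDensity_le_slope htt').trans_eq hs

/-- **`ρ⁻_μ(t) = 0` for `eᵗ ≤ y†`** — the left density vanishes up to AND INCLUDING the critical fugacity (left chords at `log y†`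
lie in the constant region). [cite: Beaton2014RotatedHoneycomb, §3.1, last paragraph (arXiv v3 p. 14: "0 for y < y_c")] -/
theorem rotLeftDensity_eq_zero_of_le {t : ℝ} (ht : Real.exp t ≤ rotYdagger) : rotLeftDensity t = 0 := by
  refine le_antisymm ?_ (rotDensities_mem_Icc t).1
  -- the left derivative is the limit of left secant slopes, all of which vanish
  have hL := hasDerivWithinAt_rotLeftDensity t
  rw [hasDerivWithinAt_iff_tendsto_slope' (show t ∉ Set.Iio t from lt_irrefl t)] at hL
  haveI : (𝓝[Set.Iio t] t).NeBot := nhdsLT_neBot t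
  refine le_of_tendsto hL (eventually_nhdsWithin_of_forall fun s hs => ?_)
  have hs' : s < t := hs
  have hsc : Real.exp s ≤ rotYdagger := (Real.exp_le_exp.2 hs'.le).trans ht
  simp only [slope_def_field, rotFreeEnergy_eq_of_le ht, rotFreeEnergy_eq_of_le hsc, sub_self, zero_div, le_refl]

/-- **The chord from the critical point bounds the left density below: `(F(t) − log μ)/(t − log y†) ≤ ρ⁻_μ(t)` for `y† < eᵗ`.**
[cite: Beaton2014RotatedHoneycomb, §3.1, Proposition 7 (arXiv v3 p. 11: "log-convex … > μ if y > y_c")] -/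
theorem div_le_rotLeftDensity {t : ℝ} (ht : rotYdagger < Real.exp t) :
    (rotFreeEnergy t - Real.log hexConnectiveConstant) / (t - Real.log rotYdagger) ≤ rotLeftDensity t := by
  have hlt : Real.log rotYdagger < t := (Real.log_lt_iff_lt_exp rotYdagger_pos).2 ht
  have h := slope_le_rotLeftDensity hlt
  rw [slope_def_field, rotFreeEnergy_eq_of_le (t := Real.log rotYdagger) (by rw [Real.exp_log rotYdagger_pos])] at h
  exact h

/-- **Adsorbed phase: `0 < ρ⁻_μ(t)` for EVERY `eᵗ > y†`** (print: "positive for `y > y_c`", read there through a.e.-differentiability;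
here for the left density at every such fugacity). [cite: Beaton2014RotatedHoneycomb, §3.1, last paragraph (arXiv v3 p. 14: "is positive for y > y_c")] -/
theorem rotLeftDensity_pos_of_gt {t : ℝ} (ht : rotYdagger < Real.exp t) : 0 < rotLeftDensity t := by
  have hlt : Real.log rotYdagger < t := (Real.log_lt_iff_lt_exp rotYdagger_pos).2 ht
  exact (div_pos (sub_pos.2 (log_hexConnectiveConstant_lt_rotFreeEnergy ht)) (sub_pos.2 hlt)).trans_le
    (div_le_rotLeftDensity ht)

/-- **THE ORDER PARAMETER: `ρ⁻_μ(t) = 0 ↔ eᵗ ≤ y†`.** [cite: Beaton2014RotatedHoneycomb, §3.1, last paragraph (arXiv v3 p. 14: "0 for y < y_c and is positive for y > y_c")] -/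
theorem rotLeftDensity_eq_zero_iff {t : ℝ} : rotLeftDensity t = 0 ↔ Real.exp t ≤ rotYdagger := by
  refine ⟨fun h => ?_, rotLeftDensity_eq_zero_of_le⟩
  by_contra hlt
  exact absurd h (rotLeftDensity_pos_of_gt (not_le.1 hlt)).ne'

/-- **`0 < ρ⁻_μ(t) ↔ y† < eᵗ`.** [cite: Beaton2014RotatedHoneycomb, §3.1, last paragraph (arXiv v3 p. 14)] -/
theorem rotLeftDensity_pos_iff {t : ℝ} : 0 < rotLeftDensity t ↔ rotYdagger < Real.exp t := by
  refine ⟨fun h => ?_, rotLeftDensity_pos_of_gt⟩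
  by_contra hle
  exact absurd (rotLeftDensity_eq_zero_of_le (not_lt.1 hle)) h.ne'

/-- `0 < ρ⁺_μ(t)` for `y† < eᵗ`. [cite: Beaton2014RotatedHoneycomb, §3.1, last paragraph (arXiv v3 p. 14)] -/
theorem rotRightDensity_pos_of_gt {t : ℝ} (ht : rotYdagger < Real.exp t) : 0 < rotRightDensity t :=
  (rotLeftDensity_pos_of_gt ht).trans_le (rotLeftDensity_le_rotRightDensity t)

/-- **`μ′(y) > 0` at every `y > y†` where `μ` is differentiable** (so almost everywhere on `(y†, ∞)`): there the derivative of
`F` at `t = log y` is `y μ′(y)/μ(y) = ρ⁻_μ(t) > 0`. [cite: Beaton2014RotatedHoneycomb, §3.1, Proposition 7 (arXiv v3 p. 11: "> μ if y > y_c") and the last paragraph of §3.1 (p. 14: "positive for y > y_c")] -/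
theorem deriv_rotSurfaceMu_pos (hy : rotYdagger < y) (hd : DifferentiableAt ℝ rotSurfaceMu y) : 0 < deriv rotSurfaceMu y := by
  have hy0 : 0 < y := rotYdagger_pos.trans hy
  have h1 : HasDerivAt Real.exp (Real.exp (Real.log y)) (Real.log y) := Real.hasDerivAt_exp _
  have h2 : HasDerivAt rotSurfaceMu (deriv rotSurfaceMu y) (Real.exp (Real.log y)) := by
    rw [Real.exp_log hy0]; exact hd.hasDerivAt
  have h3 : HasDerivAt (fun s => rotSurfaceMu (Real.exp s)) (deriv rotSurfaceMu y * Real.exp (Real.log y)) (Real.log y) :=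
    h2.comp _ h1
  have h4 : HasDerivAt rotFreeEnergy (deriv rotSurfaceMu y * Real.exp (Real.log y) / rotSurfaceMu (Real.exp (Real.log y))) (Real.log y) :=
    h3.log (rotSurfaceMu_pos _).ne'
  have h5 : rotLeftDensity (Real.log y) = deriv rotSurfaceMu y * y / rotSurfaceMu y := by
    have h := (h4.hasDerivWithinAt (s := Set.Iio (Real.log y))).derivWithin (uniqueDiffWithinAt_Iio _)
    rw [Real.exp_log hy0] at h
    exact h
  have hpos : 0 < rotLeftDensity (Real.log y) := rotLeftDensity_pos_of_gt (by rwa [Real.exp_log hy0])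
  rw [h5] at hpos
  have h' : 0 < deriv rotSurfaceMu y * y := (div_pos_iff_of_pos_right (rotSurfaceMu_pos y)).1 hpos
  exact (mul_pos_iff_of_pos_right hy0).1 h'

/-- **The surface density `y μ′(y)/μ(y)` where the derivative exists: `0` for `y < y†`, positive for `y > y†`.**
[cite: Beaton2014RotatedHoneycomb, §3.1, last paragraph (arXiv v3 p. 14: "0 for y < y_c and is positive for y > y_c")] -/
theorem rotSurfaceDensity_dichotomy (hy0 : 0 < y) (hd : DifferentiableAt ℝ rotSurfaceMu y) :
    (y < rotYdagger → y * deriv rotSurfaceMu y / rotSurfaceMu y = 0) ∧ (rotYdagger < y → 0 < y * deriv rotSurfaceMu y / rotSurfaceMu y) := by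
  refine ⟨fun h => ?_, fun h => div_pos (mul_pos hy0 (deriv_rotSurfaceMu_pos h hd)) (rotSurfaceMu_pos y)⟩
  have hz : HasDerivAt rotSurfaceMu 0 y := by
    refine (hasDerivAt_const y hexConnectiveConstant).congr_of_eventuallyEq ?_
    filter_upwards [Ioo_mem_nhds hy0 h] with z hz
    exact (rotSurfaceMu_eq_iff hz.1).2 hz.2.le
  rw [hz.deriv, mul_zero, zero_div]

/-! ### Identification with the armchair densities in the adsorbed phase -/

/-- For `y† < eᵗ`, `F = κ_rot` near `t` (`μ(y) = β_rot(y)` for `y > y†`, an open condition).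
[cite: Beaton2014RotatedHoneycomb, §3.1, Proposition 7 (arXiv v3 p. 11: "> μ if y > y_c")] -/
theorem rotFreeEnergy_eventuallyEq_armFreeEnergy {t : ℝ} (ht : rotYdagger < Real.exp t) :
    rotFreeEnergy =ᶠ[𝓝 t] armFreeEnergy := by
  have hlt : Real.log rotYdagger < t := (Real.log_lt_iff_lt_exp rotYdagger_pos).2 ht
  filter_upwards [Ioi_mem_nhds hlt] with s hs
  have hs' : rotYdagger < Real.exp s := (Real.log_lt_iff_lt_exp rotYdagger_pos).1 hs
  rw [rotFreeEnergy_apply, armFreeEnergy_apply, rotSurfaceMu_eq_armRate (Real.exp_pos s) hs']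

/-- **`ρ⁺_μ(t) = ρ⁺(t)` (the armchair wall-bridge right density) for `y† < eᵗ`.** [cite: Beaton2014RotatedHoneycomb, §3.1, Proposition 7 (arXiv v3 p. 11)] -/
theorem rotRightDensity_eq_armRightDensity {t : ℝ} (ht : rotYdagger < Real.exp t) : rotRightDensity t = armRightDensity t := by
  have h := rotFreeEnergy_eventuallyEq_armFreeEnergy ht
  rw [rotRightDensity, armRightDensity]
  exact (h.filter_mono nhdsWithin_le_nhds).derivWithin_eq h.self_of_nhds

/-- **`ρ⁻_μ(t) = ρ⁻(t)` for `y† < eᵗ`.** [cite: Beaton2014RotatedHoneycomb, §3.1, Proposition 7 (arXiv v3 p. 11)] -/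
theorem rotLeftDensity_eq_armLeftDensity {t : ℝ} (ht : rotYdagger < Real.exp t) : rotLeftDensity t = armLeftDensity t := by
  have h := rotFreeEnergy_eventuallyEq_armFreeEnergy ht
  rw [rotLeftDensity, armLeftDensity]
  exact (h.filter_mono nhdsWithin_le_nhds).derivWithin_eq h.self_of_nhds

/-- **Saturation: `ρ⁺_μ(t) → ½`.** [cite: Beaton2014RotatedHoneycomb, §3.1, Proposition 7 (arXiv v3 p. 11: "μ(y) ≥ max{μ, √y}")] -/
theorem tendsto_rotRightDensity_atTop : Tendsto rotRightDensity atTop (𝓝 (1 / 2)) := by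
  refine tendsto_armRightDensity_atTop.congr' ?_
  filter_upwards [eventually_gt_atTop (Real.log rotYdagger)] with t ht
  exact (rotRightDensity_eq_armRightDensity ((Real.log_lt_iff_lt_exp rotYdagger_pos).1 ht)).symm

/-- **Saturation: `ρ⁻_μ(t) → ½`.** [cite: Beaton2014RotatedHoneycomb, §3.1, Proposition 7 (arXiv v3 p. 11: "μ(y) ≥ max{μ, √y}")] -/
theorem tendsto_rotLeftDensity_atTop : Tendsto rotLeftDensity atTop (𝓝 (1 / 2)) := by
  refine tendsto_armLeftDensity_atTop.congr' ?_
  filter_upwards [eventually_gt_atTop (Real.log rotYdagger)] with t ht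
  exact (rotLeftDensity_eq_armLeftDensity ((Real.log_lt_iff_lt_exp rotYdagger_pos).1 ht)).symm

/-- **No saturation at a finite fugacity: `ρ⁺_μ(t) < ½` at EVERY `t`** (below the transition it is `0`; above, it is the armchair
density `< ½`; at `log y†` it is at most `ρ⁻_μ` of any larger `t`). [cite: Beaton2014RotatedHoneycomb, §3.1, Proposition 7 (arXiv v3 p. 11)] -/
theorem rotRightDensity_lt_half (t : ℝ) : rotRightDensity t < 1 / 2 := by
  -- compare with a point strictly above both `t` and `log y†`
  set t' : ℝ := max t (Real.log rotYdagger) + 1 with ht'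
  have htt' : t < t' := by rw [ht']; linarith [le_max_left t (Real.log rotYdagger)]
  have ht'c : rotYdagger < Real.exp t' := by
    refine (Real.log_lt_iff_lt_exp rotYdagger_pos).1 ?_
    rw [ht']; linarith [le_max_right t (Real.log rotYdagger)]
  calc rotRightDensity t ≤ rotLeftDensity t' := rotRightDensity_le_rotLeftDensity_of_lt htt'
    _ = armLeftDensity t' := rotLeftDensity_eq_armLeftDensity ht'c
    _ < 1 / 2 := armLeftDensity_lt_half t'

/-- `ρ⁻_μ(t) < ½` at every `t`. [cite: Beaton2014RotatedHoneycomb, §3.1, Proposition 7 (arXiv v3 p. 11)] -/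
theorem rotLeftDensity_lt_half (t : ℝ) : rotLeftDensity t < 1 / 2 :=
  (rotLeftDensity_le_rotRightDensity t).trans_lt (rotRightDensity_lt_half t)

/-! ### The exceptional set is countable -/

/-- **The fugacities at which the left and right densities differ form a countable set** — the open intervals
`(ρ⁻_μ(t), ρ⁺_μ(t))` are pairwise disjoint (interlacing), and each contains a rational.
[cite: Beaton2014RotatedHoneycomb, §3.1, Proposition 7 (arXiv v3 p. 11: "almost everywhere differentiable")] -/
theorem countable_setOf_rotLeftDensity_lt_rotRightDensity : {t : ℝ | rotLeftDensity t < rotRightDensity t}.Countable := by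
  set s : Set ℝ := {t : ℝ | rotLeftDensity t < rotRightDensity t} with hs
  have hq : ∀ t ∈ s, ∃ q : ℚ, rotLeftDensity t < (q : ℝ) ∧ (q : ℝ) < rotRightDensity t := fun t ht => exists_rat_btwn ht
  choose! q hq using hq
  refine Set.MapsTo.countable_of_injOn (Set.mapsTo_univ q s) (fun t ht t' ht' hqq => ?_) Set.countable_univ
  by_contra hne
  rcases lt_or_gt_of_ne hne with h | h
  · have h1 := (hq t ht).2.trans_le ((rotRightDensity_le_rotLeftDensity_of_lt h).trans (hq t' ht').1.le)
    rw [hqq] at h1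
    exact lt_irrefl _ h1
  · have h1 := (hq t' ht').2.trans_le ((rotRightDensity_le_rotLeftDensity_of_lt h).trans (hq t ht).1.le)
    rw [hqq] at h1
    exact lt_irrefl _ h1

/-- Off the countable exceptional set, `F` is differentiable at `t` with derivative `ρ⁺_μ(t) = ρ⁻_μ(t)`.
[cite: Beaton2014RotatedHoneycomb, §3.1, Proposition 7 (arXiv v3 p. 11: "almost everywhere differentiable")] -/
theorem hasDerivAt_rotFreeEnergy_of_eq {t : ℝ} (h : rotLeftDensity t = rotRightDensity t) :
    HasDerivAt rotFreeEnergy (rotRightDensity t) t := by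
  have hL := hasDerivWithinAt_rotLeftDensity t
  have hR := hasDerivWithinAt_rotRightDensity t
  rw [h] at hL
  have hu := hL.union hR
  rw [Set.Iio_union_Ioi, Set.compl_eq_univ_sdiff, hasDerivWithinAt_sdiff_singleton, hasDerivWithinAt_univ] at hu
  exact hu

/-! ### The finite-`n` density is squeezed by the one-sided densities at EVERY fugacity -/

/-- **`ρ⁺_μ(t) < b ⇒ density_n(eᵗ) < b` eventually in `n`** (at every `t`): the right derivative is the limit of right secant slopes,
so some right secant of `F` has slope `< b`; then `HexSAWRotSurfaceDensityLimit.eventually_rotSurfDensity_lt`.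
[cite: Beaton2014RotatedHoneycomb, §3.1, last paragraph (arXiv v3 p. 14: "this density tends to y ∂ log μ(y)/∂y")] -/
theorem eventually_rotSurfDensity_lt_of_lt {t b : ℝ} (hb : rotRightDensity t < b) :
    ∀ᶠ n : ℕ in atTop, rotSurfDensity n (Real.exp t) < b := by
  have hR := hasDerivWithinAt_rotRightDensity t
  rw [hasDerivWithinAt_iff_tendsto_slope' (show t ∉ Set.Ioi t from lt_irrefl t)] at hR
  have h1 : ∀ᶠ t' in 𝓝[Set.Ioi t] t, slope rotFreeEnergy t t' < b := hR.eventually (gt_mem_nhds hb)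
  obtain ⟨t', ht'b, ht't⟩ := (h1.and eventually_mem_nhdsWithin).exists
  have hq : slope rotFreeEnergy t t' =
      (Real.log (rotSurfaceMu (Real.exp t')) - Real.log (rotSurfaceMu (Real.exp t))) / (t' - t) := slope_def_field _ t t'
  rw [hq] at ht'b
  exact eventually_rotSurfDensity_lt ht't ht'b

/-- **`a < ρ⁻_μ(t) ⇒ a < density_n(eᵗ)` eventually in `n`** (at every `t`). [cite: Beaton2014RotatedHoneycomb, §3.1, last paragraph (arXiv v3 p. 14)] -/
theorem eventually_lt_rotSurfDensity_of_lt {t a : ℝ} (ha : a < rotLeftDensity t) :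
    ∀ᶠ n : ℕ in atTop, a < rotSurfDensity n (Real.exp t) := by
  have hL := hasDerivWithinAt_rotLeftDensity t
  rw [hasDerivWithinAt_iff_tendsto_slope' (show t ∉ Set.Iio t from lt_irrefl t)] at hL
  have h1 : ∀ᶠ t' in 𝓝[Set.Iio t] t, a < slope rotFreeEnergy t t' := hL.eventually (lt_mem_nhds ha)
  obtain ⟨t', ht'a, ht't⟩ := (h1.and eventually_mem_nhdsWithin).exists
  have hq : slope rotFreeEnergy t t' =
      (Real.log (rotSurfaceMu (Real.exp t')) - Real.log (rotSurfaceMu (Real.exp t))) / (t' - t) := slope_def_field _ t t'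
  rw [hq] at ht'a
  exact eventually_lt_rotSurfDensity ht't ht'a

/-- **`limsup_n density_n(eᵗ) ≤ ρ⁺_μ(t)`**, `ε`-form: for every `ε > 0`, eventually `density_n(eᵗ) ≤ ρ⁺_μ(t) + ε`.
[cite: Beaton2014RotatedHoneycomb, §3.1, last paragraph (arXiv v3 p. 14)] -/
theorem eventually_rotSurfDensity_le (t : ℝ) {ε : ℝ} (hε : 0 < ε) :
    ∀ᶠ n : ℕ in atTop, rotSurfDensity n (Real.exp t) ≤ rotRightDensity t + ε :=
  (eventually_rotSurfDensity_lt_of_lt (by linarith : rotRightDensity t < rotRightDensity t + ε)).mono fun _ h => h.le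

/-- **`ρ⁻_μ(t) ≤ liminf_n density_n(eᵗ)`**, `ε`-form: for every `ε > 0`, eventually `ρ⁻_μ(t) − ε ≤ density_n(eᵗ)`.
[cite: Beaton2014RotatedHoneycomb, §3.1, last paragraph (arXiv v3 p. 14)] -/
theorem eventually_le_rotSurfDensity (t : ℝ) {ε : ℝ} (hε : 0 < ε) :
    ∀ᶠ n : ℕ in atTop, rotLeftDensity t - ε ≤ rotSurfDensity n (Real.exp t) :=
  (eventually_lt_rotSurfDensity_of_lt (by linarith : rotLeftDensity t - ε < rotLeftDensity t)).mono fun _ h => h.le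

/-- **Where the two densities agree, the finite-`n` density converges to them: `ρ⁻_μ(t) = ρ⁺_μ(t) → density_n(eᵗ) → ρ⁺_μ(t)`.**
[cite: Beaton2014RotatedHoneycomb, §3.1, last paragraph (arXiv v3 p. 14: "In the limit of infinitely long walks, this density tends to y ∂ log μ(y)/∂y")] -/
theorem tendsto_rotSurfDensity_exp_of_eq {t : ℝ} (h : rotLeftDensity t = rotRightDensity t) :
    Tendsto (fun n : ℕ => rotSurfDensity n (Real.exp t)) atTop (𝓝 (rotRightDensity t)) := by
  rw [tendsto_order]
  refine ⟨fun a ha => eventually_lt_rotSurfDensity_of_lt (h ▸ ha), fun b hb => eventually_rotSurfDensity_lt_of_lt hb⟩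

/-- **The printed limit holds at every fugacity outside a countable set**: for `t ∉ {t | ρ⁻_μ(t) < ρ⁺_μ(t)}` (countable,
`countable_setOf_rotLeftDensity_lt_rotRightDensity`), `density_n(eᵗ) → ρ⁺_μ(t) = d F/dt (t)`.
[cite: Beaton2014RotatedHoneycomb, §3.1, last paragraph (arXiv v3 p. 14)] -/
theorem tendsto_rotSurfDensity_exp_of_not_mem {t : ℝ} (ht : t ∉ {t : ℝ | rotLeftDensity t < rotRightDensity t}) :
    Tendsto (fun n : ℕ => rotSurfDensity n (Real.exp t)) atTop (𝓝 (rotRightDensity t)) :=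
  tendsto_rotSurfDensity_exp_of_eq (le_antisymm (rotLeftDensity_le_rotRightDensity t) (not_lt.1 ht))

/-- **Adsorbed phase, every `y > y_c`, explicit**: for `y† < eᵗ` and `ε > 0`, eventually
`density_n(eᵗ) ≥ (F(t) − log μ)/(t − log y†) − ε` — a POSITIVE explicit lower bound on the surface density of long walks.
[cite: Beaton2014RotatedHoneycomb, §3.1, last paragraph (arXiv v3 p. 14: "is positive for y > y_c")] -/
theorem eventually_div_sub_le_rotSurfDensity {t : ℝ} (ht : rotYdagger < Real.exp t) {ε : ℝ} (hε : 0 < ε) :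
    ∀ᶠ n : ℕ in atTop,
      (rotFreeEnergy t - Real.log hexConnectiveConstant) / (t - Real.log rotYdagger) - ε ≤ rotSurfDensity n (Real.exp t) :=
  (eventually_le_rotSurfDensity t hε).mono fun _ h => (sub_le_sub_right (div_le_rotLeftDensity ht) ε).trans h

/-- **Large fugacity: the densities of long walks approach `½`** — for every `δ > 0` there is `T` such that for each `t ≥ T`,
eventually in `n`, `½ − δ ≤ density_n(eᵗ) ≤ ½ + δ`. [cite: Beaton2014RotatedHoneycomb, §3.1, Proposition 7 (arXiv v3 p. 11: "μ(y) ≥ max{μ, √y}") and last paragraph (p. 14)] -/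
theorem exists_forall_eventually_rotSurfDensity_near_half {δ : ℝ} (hδ : 0 < δ) :
    ∃ T : ℝ, ∀ t : ℝ, T ≤ t → ∀ᶠ n : ℕ in atTop,
      1 / 2 - δ ≤ rotSurfDensity n (Real.exp t) ∧ rotSurfDensity n (Real.exp t) ≤ 1 / 2 + δ := by
  have h := tendsto_rotLeftDensity_atTop.eventually (Ioi_mem_nhds (by linarith : 1 / 2 - δ / 2 < 1 / 2))
  obtain ⟨T, hT⟩ := h.exists_forall_of_atTop
  refine ⟨T, fun t ht => ?_⟩
  have hlow : 1 / 2 - δ / 2 < rotLeftDensity t := hT t ht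
  filter_upwards [eventually_le_rotSurfDensity t (half_pos hδ), eventually_rotSurfDensity_le t (half_pos hδ)] with n h1 h2
  exact ⟨by linarith, by linarith [(rotDensities_mem_Icc t).2.2]⟩

end Literature.Probability.RandomPlanarGeometry.SAW.HV

/-! ## EDITION 3 (appended) — differentiability fails only on a COUNTABLE set: the printed "almost everywhere differentiable"
sharpened, for `β_rot` (armchair wall-bridge rate) and for Beaton's `μ(y)`, in the fugacity variable `y` -/

namespace Literature.Probability.RandomPlanarGeometry.SAW.HexBW.Arm

open HV

/-- **The fugacities (in `t = log y`) where the armchair densities differ form a countable set** — the open intervals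
`(ρ⁻(t), ρ⁺(t))` are pairwise disjoint by the interlacing `armRightDensity_le_armLeftDensity_of_lt`.
[cite: Beaton2014RotatedHoneycomb, §3.1, Proposition 7 (arXiv v3 p. 11: "almost everywhere differentiable")] -/
theorem countable_setOf_armLeftDensity_lt_armRightDensity : {t : ℝ | armLeftDensity t < armRightDensity t}.Countable := by
  set s : Set ℝ := {t : ℝ | armLeftDensity t < armRightDensity t} with hs
  have hq : ∀ t ∈ s, ∃ q : ℚ, armLeftDensity t < (q : ℝ) ∧ (q : ℝ) < armRightDensity t := fun t ht => exists_rat_btwn ht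
  choose! q hq using hq
  refine Set.MapsTo.countable_of_injOn (Set.mapsTo_univ q s) (fun t ht t' ht' hqq => ?_) Set.countable_univ
  by_contra hne
  rcases lt_or_gt_of_ne hne with h | h
  · have h1 := (hq t ht).2.trans_le ((armRightDensity_le_armLeftDensity_of_lt h).trans (hq t' ht').1.le)
    rw [hqq] at h1
    exact lt_irrefl _ h1
  · have h1 := (hq t' ht').2.trans_le ((armRightDensity_le_armLeftDensity_of_lt h).trans (hq t ht).1.le)
    rw [hqq] at h1
    exact lt_irrefl _ h1

/-- Where the two armchair densities agree, `κ_rot` is differentiable with derivative `ρ⁺(t)`.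
[cite: Beaton2014RotatedHoneycomb, §3.1, Proposition 7 (arXiv v3 p. 11: "almost everywhere differentiable")] -/
theorem hasDerivAt_armFreeEnergy_of_eq {t : ℝ} (h : armLeftDensity t = armRightDensity t) :
    HasDerivAt armFreeEnergy (armRightDensity t) t := by
  have hL := hasDerivWithinAt_armLeftDensity t
  have hR := hasDerivWithinAt_armRightDensity t
  rw [h] at hL
  have hu := hL.union hR
  rw [Set.Iio_union_Ioi, Set.compl_eq_univ_sdiff, hasDerivWithinAt_sdiff_singleton, hasDerivWithinAt_univ] at hu
  exact hu

/-- Conversely, where `κ_rot` is differentiable the two densities agree (both are the derivative).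
[cite: Beaton2014RotatedHoneycomb, §3.1, Proposition 7 (arXiv v3 p. 11)] -/
theorem armLeftDensity_eq_armRightDensity_of_differentiableAt {t : ℝ} (hd : DifferentiableAt ℝ armFreeEnergy t) :
    armLeftDensity t = armRightDensity t := by
  have h := hd.hasDerivAt
  rw [armLeftDensity, armRightDensity, (h.hasDerivWithinAt (s := Set.Iio t)).derivWithin (uniqueDiffWithinAt_Iio t),
    (h.hasDerivWithinAt (s := Set.Ioi t)).derivWithin (uniqueDiffWithinAt_Ioi t)]

/-- `β_rot` is differentiable at `y = eᵗ` iff `κ_rot` is differentiable at `t` (`β_rot = exp ∘ κ_rot ∘ log` on `(0, ∞)`).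
[cite: Beaton2014RotatedHoneycomb, §3.1, Proposition 7 (arXiv v3 p. 11)] -/
theorem differentiableAt_armRate_exp_iff (t : ℝ) : DifferentiableAt ℝ armRate (Real.exp t) ↔ DifferentiableAt ℝ armFreeEnergy t := by
  constructor
  · intro hd
    have h1 : DifferentiableAt ℝ (fun s : ℝ => armRate (Real.exp s)) t := hd.comp t (Real.differentiableAt_exp)
    exact h1.log (armRate_pos _).ne'
  · intro hd
    -- `armRate y = exp (κ_rot (log y))` near `eᵗ`
    have hev : armRate =ᶠ[𝓝 (Real.exp t)] fun y : ℝ => Real.exp (armFreeEnergy (Real.log y)) := by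
      filter_upwards [Ioi_mem_nhds (Real.exp_pos t)] with y hy
      rw [armFreeEnergy_apply, Real.exp_log hy, Real.exp_log (armRate_pos y)]
    have hlog : DifferentiableAt ℝ Real.log (Real.exp t) := Real.differentiableAt_log (Real.exp_pos t).ne'
    have hd' : DifferentiableAt ℝ armFreeEnergy (Real.log (Real.exp t)) := by rwa [Real.log_exp]
    have h2 : DifferentiableAt ℝ (fun y : ℝ => Real.exp (armFreeEnergy (Real.log y))) (Real.exp t) :=
      (hd'.comp (Real.exp t) hlog).exp
    exact h2.congr_of_eventuallyEq hev

/-- **`β_rot` is differentiable at every `y > 0` outside a COUNTABLE set** — the printed "almost everywhere differentiable"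
(Lebesgue-null, via monotonicity) sharpened to "all but countably many `y`" (via convexity). [cite: Beaton2014RotatedHoneycomb, §3.1, Proposition 7 (arXiv v3 p. 11: "almost everywhere differentiable"); HammersleyTorrieWhittington1982, §2] -/
theorem countable_setOf_not_differentiableAt_armRate : {y : ℝ | 0 < y ∧ ¬ DifferentiableAt ℝ armRate y}.Countable := by
  refine (countable_setOf_armLeftDensity_lt_armRightDensity.image Real.exp).mono fun y hy => ?_
  obtain ⟨hy0, hnd⟩ := hy
  refine ⟨Real.log y, ?_, Real.exp_log hy0⟩
  -- if the densities agreed at `log y`, `κ_rot` and hence `β_rot` would be differentiable there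
  refine lt_of_le_of_ne (armLeftDensity_le_armRightDensity _) fun heq => hnd ?_
  have h := (differentiableAt_armRate_exp_iff (Real.log y)).2 (hasDerivAt_armFreeEnergy_of_eq heq).differentiableAt
  rwa [Real.exp_log hy0] at h

end Literature.Probability.RandomPlanarGeometry.SAW.HexBW.Arm

namespace Literature.Probability.RandomPlanarGeometry.SAW.HV

open HexBW HexBW.Arm

variable {y : ℝ}

/-- Where `F` is differentiable the two densities of Beaton's `μ(y)` agree.
[cite: Beaton2014RotatedHoneycomb, §3.1, Proposition 7 (arXiv v3 p. 11)] -/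
theorem rotLeftDensity_eq_rotRightDensity_of_differentiableAt {t : ℝ} (hd : DifferentiableAt ℝ rotFreeEnergy t) :
    rotLeftDensity t = rotRightDensity t := by
  have h := hd.hasDerivAt
  rw [rotLeftDensity, rotRightDensity, (h.hasDerivWithinAt (s := Set.Iio t)).derivWithin (uniqueDiffWithinAt_Iio t),
    (h.hasDerivWithinAt (s := Set.Ioi t)).derivWithin (uniqueDiffWithinAt_Ioi t)]

/-- `μ(·)` is differentiable at `y = eᵗ` iff `F` is differentiable at `t`. [cite: Beaton2014RotatedHoneycomb, §3.1, Proposition 7 (arXiv v3 p. 11)] -/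
theorem differentiableAt_rotSurfaceMu_exp_iff (t : ℝ) :
    DifferentiableAt ℝ rotSurfaceMu (Real.exp t) ↔ DifferentiableAt ℝ rotFreeEnergy t := by
  constructor
  · intro hd
    have h1 : DifferentiableAt ℝ (fun s : ℝ => rotSurfaceMu (Real.exp s)) t := hd.comp t (Real.differentiableAt_exp)
    exact h1.log (rotSurfaceMu_pos _).ne'
  · intro hd
    have hev : rotSurfaceMu =ᶠ[𝓝 (Real.exp t)] fun y : ℝ => Real.exp (rotFreeEnergy (Real.log y)) := by
      filter_upwards [Ioi_mem_nhds (Real.exp_pos t)] with y hy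
      rw [rotFreeEnergy_apply, Real.exp_log hy, Real.exp_log (rotSurfaceMu_pos y)]
    have hlog : DifferentiableAt ℝ Real.log (Real.exp t) := Real.differentiableAt_log (Real.exp_pos t).ne'
    have hd' : DifferentiableAt ℝ rotFreeEnergy (Real.log (Real.exp t)) := by rwa [Real.log_exp]
    have h2 : DifferentiableAt ℝ (fun y : ℝ => Real.exp (rotFreeEnergy (Real.log y))) (Real.exp t) :=
      (hd'.comp (Real.exp t) hlog).exp
    exact h2.congr_of_eventuallyEq hev

/-- **Beaton's `μ(·)` is differentiable at every `y > 0` outside a COUNTABLE set** (print: "almost everywhere differentiable").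
[cite: Beaton2014RotatedHoneycomb, §3.1, Proposition 7 (arXiv v3 p. 11: "almost everywhere differentiable")] -/
theorem countable_setOf_not_differentiableAt_rotSurfaceMu :
    {y : ℝ | 0 < y ∧ ¬ DifferentiableAt ℝ rotSurfaceMu y}.Countable := by
  refine (countable_setOf_rotLeftDensity_lt_rotRightDensity.image Real.exp).mono fun y hy => ?_
  obtain ⟨hy0, hnd⟩ := hy
  refine ⟨Real.log y, ?_, Real.exp_log hy0⟩
  refine lt_of_le_of_ne (rotLeftDensity_le_rotRightDensity _) fun heq => hnd ?_
  have h := (differentiableAt_rotSurfaceMu_exp_iff (Real.log y)).2 (hasDerivAt_rotFreeEnergy_of_eq heq).differentiableAt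
  rwa [Real.exp_log hy0] at h

/-- **At every `y > 0` outside that countable set the surface density of long walks CONVERGES** (to `y μ′(y)/μ(y)`):
the printed limit statement with its exceptional set made explicit and countable.
[cite: Beaton2014RotatedHoneycomb, §3.1, last paragraph (arXiv v3 p. 14: "this density tends to y ∂ log μ(y)/∂y")] -/
theorem tendsto_rotSurfDensity_of_not_mem (hy : 0 < y) (h : y ∉ {y : ℝ | 0 < y ∧ ¬ DifferentiableAt ℝ rotSurfaceMu y}) :
    Tendsto (fun n : ℕ => rotSurfDensity n y) atTop (𝓝 (y * deriv rotSurfaceMu y / rotSurfaceMu y)) := by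
  have hd : DifferentiableAt ℝ rotSurfaceMu y := by
    by_contra hnd
    exact h ⟨hy, hnd⟩
  exact tendsto_rotSurfDensity hy hd

end Literature.Probability.RandomPlanarGeometry.SAW.HV
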